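import Summits.Ventures.PercRepro.RankLevelSetAbsorbNormNullityAll
import Summits.Ventures.PercRepro.RankLevelSetStarPlusThree

/-! # RankLevelSetCellPropsClasses — THE CLASSES ON WHICH ALL FIVE OF THE CELL'S `Prop`s ARE PROVED (night-1 g36;
dossier §48.18; on `RankLevelSetAbsorbNormNullityAll` and `RankLevelSetStarPlusThree`)

One theorem per class, each the conjunction `BiIndepPerElem M ∧ BiIndepMono M ∧ BiIndepAbsorbStar M ∧
BiIndepStarPlus M ∧ BiIndepAbsorbNormSkew M`: **`cellProps_of_ncard_le_eight`** (`#E ≤ 8`),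
**`cellProps_of_eRank_le_four`** (`rk M ≤ 4`) and, restated from `RankLevelSetAbsorbNormNullityAll`,
`cellProps_of_nullity` (`rk M✶ ≤ 3`); **`cellProps_of_eRank_le_four_or_nullity_or_ncard`** collects the three.
The components are the landed class theorems (`biIndepPerElem_of_ncard_le_eleven`, `biIndepPerElem_of_eRank_le_six`,
`absorbStar_of_ncard_le_eight`, `absorbStar_of_eRank_le_four`, `biIndepStarPlus_of_ncard_le_eight`,
`biIndepStarPlus_of_eRank_le_four`, `absorbNormSkew_of_ncard_le_eight`, `absorbNormSkew_of_eRank_le_four`).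
Every declaration has a docstring; imports: the cell's own modules and Mathlib only. Axioms: standard. -/

namespace PercRepro

open Set Matroid

variable {α : Type} (M : Matroid α) [M.Finite]

/-- **ALL FIVE PROPS ON EVERY MATROID WITH AT MOST `8` ELEMENTS.** -/
theorem cellProps_of_ncard_le_eight [DecidableEq α] (hn : M.E.ncard ≤ 8) :
    BiIndepPerElem M ∧ BiIndepMono M ∧ BiIndepAbsorbStar M ∧ BiIndepStarPlus M ∧ BiIndepAbsorbNormSkew M :=
  ⟨biIndepPerElem_of_ncard_le_eleven M (by omega), biIndepMono_of_ncard_le_eleven M (by omega),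
    absorbStar_of_ncard_le_eight M hn, biIndepStarPlus_of_ncard_le_eight M hn, absorbNormSkew_of_ncard_le_eight M hn⟩

/-- **ALL FIVE PROPS ON EVERY MATROID OF RANK AT MOST `4`.** -/
theorem cellProps_of_eRank_le_four [DecidableEq α] (hr : M.eRank ≤ 4) :
    BiIndepPerElem M ∧ BiIndepMono M ∧ BiIndepAbsorbStar M ∧ BiIndepStarPlus M ∧ BiIndepAbsorbNormSkew M :=
  ⟨biIndepPerElem_of_eRank_le_six M (le_trans hr (by norm_num)),
    biIndepMono_of_eRank_le_six M (le_trans hr (by norm_num)), absorbStar_of_eRank_le_four M hr,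
    biIndepStarPlus_of_eRank_le_four M hr, absorbNormSkew_of_eRank_le_four M hr⟩

/-- **ALL FIVE PROPS ON EVERY MATROID OF RANK `≤ 4`, OR OF NULLITY `≤ 3`, OR WITH `≤ 8` ELEMENTS.** -/
theorem cellProps_of_eRank_le_four_or_nullity_or_ncard [DecidableEq α]
    (h : M.eRank ≤ 4 ∨ M✶.eRank ≤ 3 ∨ M.E.ncard ≤ 8) :
    BiIndepPerElem M ∧ BiIndepMono M ∧ BiIndepAbsorbStar M ∧ BiIndepStarPlus M ∧ BiIndepAbsorbNormSkew M := by
  rcases h with hr | hν | hn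
  · exact cellProps_of_eRank_le_four M hr
  · exact cellProps_of_nullity M hν
  · exact cellProps_of_ncard_le_eight M hn

end PercRepro
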